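import Literature.NumberTheory.EllipticCurves.KramerTunnell1982.UnramifiedQuadraticNormProofs
import Literature.NumberTheory.EllipticCurves.Kramer1981.RamifiedOddGoodNormIndexProofs
import Literature.NumberTheory.GaloisRepresentations.LocalFieldFiniteExtension
import Literature.NumberTheory.DiophantineGeometry.TateAlgorithmProofs
import HarnessLib

/-!
# Kramer–Tunnell 1982, Lemma 6.1, type `I₀` — PROVED: the unramified quadratic norm index is `1`
for good reduction

K. Kramer, J. Tunnell, *Elliptic curves and local ε-factors*, Compositio Math. **46** (1982),
§6, Lemma 6.1 (p. 327): for `K/F` the unramified quadratic extension of a non-archimedean local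
field and `E/F` an elliptic curve, `[E(F) : N E(K)] = 2^d` with `d ≡ m - 1 (mod 2)` (`m` the
number of components of the Néron fibre), and the index is `1` for the types `I₀, I_v (v odd), II,
II*, IV, IV*`.  This file proves the **type-`I₀` (good reduction) case** of the tree's named fact
`KramerTunnell1982.lemma61_unramifiedNormIndex` (`UnramifiedNormIndex.lean`), verbatim in its
vocabulary and with its generality — `F` any non-archimedean local field (any characteristic, any
residue characteristic), `K' ⊆ F_nr` quadratic, `σ ≠ 1`:

* `lemma61_unramifiedNormIndex_typeI0` — for `E.kodairaSymbol 𝒪[F] = I₀`: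
  `(∃ d, [E(K')^σ : N E(K')] = 2^d ∧ d ≡ numComponents - 1 (mod 2)) ∧ [E(K')^σ : N E(K')] = 1`;
* `exists_map_sub_eq_of_kodairaSymbol_I_zero` — `H¹(⟨σ⟩, E(K')) = 0` for type `I₀`;
* `relIndex_normSubgroup_fixedSubgroup_eq_one_of_isUnit_Δ`, `exists_map_sub_eq_of_isUnit_Δ` — the
  same for any Weierstrass model `W` over `𝒪[F]` with unit discriminant;
* `range_baseChange_eq_fixedSubgroup_of_finrank_two` — quadratic Galois descent for points in any
  characteristic (`E(K')^σ = ι E(F)`, so the index above is the printed `[E(F) : N E(K')]`);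
* `lemma61_unramifiedNormIndex_of_ne_I_zero` — bookkeeping: the named fact follows from its
  restriction to `E.kodairaSymbol 𝒪[F] ≠ I₀`.

## Proof (following Kramer–Tunnell, p. 327: "It follows from Lang's theorem [9] that
`N : E₀(K) → E₀(F)` is surjective")

The abstract assembly is `UnramifiedQuadraticNormProofs` (`Ĥ⁰ = H¹ = 0` on `E(K)` for an
isometric involution `σ ≠ 1` of a local field `K` fixing a uniformiser, from Lang on the reduction
`FiniteFieldQuadraticLangProofs`, the formal-group layer `KernelReductionNormProofs` and Hensel
`GoodReductionNormProofs`).  Here (§5) the quadratic unramified `K' ⊆ F̄` is given its local-field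
structure (`GaloisRepresentations.FiniteExtension.*`: the spectral norm, Serre II §2), whose
valuation is the restriction of `|·|_{F̄}` (`finiteExtension_vle_iff_algNorm_le`); then `σ` is an
isometry (`Kramer1981.algNorm_algEquiv`), an involution (`#Aut ≤ 2`), a uniformiser `ϖ` of `F`
stays a uniformiser (`exists_algNorm_eq_zpow_of_mem_maxUnramified`: `F_nr/F` is unramified), and
`W ⊗ K'` is integral with unit discriminant.  §6 passes from `E` to its minimal model
(`Kramer1981.relIndex_norm_fixed_smul`, `kodairaSymbol_eq_I_zero_iff`); §4 is quadratic Galois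
descent for points in any characteristic.  The point-level statements carry an explicit
`[DecidableEq K']` (the group law on `E(K')` is stated through one; the abstract theorems use the
classical instance, and all such instances are equal — `Subsingleton.elim` + `subst` in the proofs).

Theorems only: no definition, no named fact, no `sorry` (D-0026: net debt `0`; the named fact
`lemma61_unramifiedNormIndex` itself — all Kodaira types — stays open: types `I_v`, `I_v^*`,
`I₀^*`, `II–IV^*` need the Néron component group, Stage 2–3 of the unit's plan).

## References

* [KramerTunnell1982] K. Kramer, J. Tunnell, Compositio Math. 46 (1982), §6 Lemma 6.1 (p. 327);
  §5 proof of Prop. 5.11 (p. 326) (`E(F)/NE(K) ≅ Ĥ⁰(G, E(K))`).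
* [SerreLocalFields1979] J.-P. Serre, *Local Fields*, GTM 67, Ch. II §2 Prop. 3 and Cor. 2–3
  (prolongation of the valuation, isometric automorphisms), Ch. IV §4 Prop. 16 (unramified).
* [SilvermanAEC2009] J. H. Silverman, *The Arithmetic of Elliptic Curves*, VII.1–2, III.3.1(b).
-/

noncomputable section

open scoped Classical NNReal
open ValuativeRel Field
open Literature.NumberTheory.GaloisRepresentations
open Literature.NumberTheory.GaloisRepresentations.IsNonarchimedeanLocalField
open Literature.NumberTheory.EllipticCurves.FormalGroupChart
open _root_.WeierstrassCurve

universe u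

namespace Literature.NumberTheory.EllipticCurves.KramerTunnell1982



/-! ## §4 Quadratic Galois descent (any characteristic) -/

section Descent

variable {F : Type*} [Field F] {L : Type*} [Field L] [Algebra F L]

/-- In a quadratic extension the non-trivial automorphism is an involution (`#Aut(L/F) ≤ 2`,
Mathlib `AlgEquiv.card_le`). [folklore] -/
private theorem algEquiv_mul_self_of_finrank_two (h2 : Module.finrank F L = 2)
    {σ : L ≃ₐ[F] L} (hσ : σ ≠ 1) : σ * σ = 1 := by
  haveI : FiniteDimensional F L := Module.finite_of_finrank_eq_succ h2
  by_contra hne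
  have h3 : 2 < Fintype.card (L ≃ₐ[F] L) := by
    rw [Fintype.two_lt_card_iff]
    refine ⟨1, σ, σ * σ, hσ.symm, fun h => hne h.symm, fun h => hσ ?_⟩
    calc σ = σ⁻¹ * (σ * σ) := by rw [← mul_assoc, inv_mul_cancel, one_mul]
      _ = σ⁻¹ * σ := by rw [← h]
      _ = 1 := inv_mul_cancel σ
  have h4 := AlgEquiv.card_le (F := F) (K := L)
  omega

/-- **`L^σ = F` for a quadratic extension `L/F` with a non-trivial automorphism `σ`** (any
characteristic): an element fixed by `σ` lies in `F`.  Artin's theorem for `⟨σ⟩` (Mathlib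
`IntermediateField.finrank_fixedField_eq_card`): `[L : L^{⟨σ⟩}] = 2 = [L : F]`.  This is the
equality `E(K)^G ⊇ E(F)`-direction input "`K^G = F`" of Kramer–Tunnell's `E(F)/NE(K) ≅ Ĥ⁰(G, E(K))`.
[cite: KramerTunnell1982, §5 proof of Prop. 5.11 (p. 326), E(F) = E(K)^G] -/
theorem exists_eq_algebraMap_of_fixed_of_finrank_two (h2 : Module.finrank F L = 2)
    {σ : L ≃ₐ[F] L} (hσ : σ ≠ 1) {y : L} (hy : σ y = y) : ∃ a : F, y = algebraMap F L a := by
  haveI : FiniteDimensional F L := Module.finite_of_finrank_eq_succ h2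
  have hσσ : σ * σ = 1 := algEquiv_mul_self_of_finrank_two h2 hσ
  have hcard : Nat.card (Subgroup.zpowers σ) = 2 := by
    rw [Nat.card_zpowers, orderOf_eq_prime (by rw [sq]; exact hσσ) hσ]
  have hL : Module.finrank F (IntermediateField.fixedField (Subgroup.zpowers σ)) = 1 := by
    have ht := Module.finrank_mul_finrank F (IntermediateField.fixedField (Subgroup.zpowers σ)) L
    rw [IntermediateField.finrank_fixedField_eq_card, hcard, h2] at ht
    omega
  have hyL : y ∈ IntermediateField.fixedField (Subgroup.zpowers σ) := by
    rw [IntermediateField.mem_fixedField_iff]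
    intro f hf
    obtain ⟨j, rfl⟩ := Subgroup.mem_zpowers_iff.mp hf
    exact MulAction.fixedBy_subset_fixedBy_zpow L σ j hy
  rw [IntermediateField.finrank_eq_one_iff.mp hL, IntermediateField.mem_bot] at hyL
  obtain ⟨a, ha⟩ := hyL
  exact ⟨a, ha.symm⟩

/-- `(σ : L →ₐ[F] L) z = σ z` (unfolding). [folklore] -/
private theorem algHom_coe_apply'' (σ : L ≃ₐ[F] L) (z : L) : (σ : L →ₐ[F] L) z = σ z := rfl

variable [DecidableEq F] [DecidableEq L]

/-- **Galois descent for points over a quadratic extension** (any characteristic): a point of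
`E(L)` fixed by the non-trivial automorphism `σ` of the quadratic extension `L/F` is the image of a
point of `E(F)` (its coordinates lie in `L^σ = F`, `exists_eq_algebraMap_of_fixed_of_finrank_two`);
the characteristic-free form of `Kramer1981.exists_baseChange_eq_of_map_eq`.
[cite: KramerTunnell1982, §5 proof of Prop. 5.11 (p. 326), E(F) = E(K)^G] -/
theorem exists_baseChange_eq_of_map_eq_of_finrank_two (V : WeierstrassCurve F)
    (h2 : Module.finrank F L = 2) {σ : L ≃ₐ[F] L} (hσ : σ ≠ 1)
    {Q : (V.baseChange L).toAffine.Point}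
    (hQ : WeierstrassCurve.Affine.Point.map (W' := V) (σ : L →ₐ[F] L) Q = Q) :
    ∃ P : (V.baseChange F).toAffine.Point,
      WeierstrassCurve.Affine.Point.baseChange (W' := V) F L P = Q := by
  rcases Q with _ | ⟨u, v, h⟩
  · exact ⟨0, rfl⟩
  · rw [Affine.Point.map_some] at hQ
    simp only [Affine.Point.some.injEq, algHom_coe_apply''] at hQ
    obtain ⟨a, rfl⟩ : ∃ a : F, Algebra.ofId F L a = u :=
      let ⟨a, ha⟩ := exists_eq_algebraMap_of_fixed_of_finrank_two h2 hσ hQ.1; ⟨a, ha.symm⟩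
    obtain ⟨b, rfl⟩ : ∃ b : F, Algebra.ofId F L b = v :=
      let ⟨b, hb⟩ := exists_eq_algebraMap_of_fixed_of_finrank_two h2 hσ hQ.2; ⟨b, hb.symm⟩
    exact ⟨Affine.Point.some a b
      ((V.toAffine.baseChange_nonsingular (Algebra.ofId F L).injective a b).mp h), by
        rw [Affine.Point.baseChange, Affine.Point.map_some]⟩

/-- **`E(L)^σ = ι(E(F))`** for a quadratic extension `L/F` with non-trivial automorphism `σ` (any
characteristic): the `σ`-fixed subgroup of `E(L)` is the range of the base change
`ι : E(F) →+ E(L)`; so `(normSubgroup).relIndex (fixedSubgroup)` is the printed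
`[E(F) : N E(L)]`.  Characteristic-free form of `Kramer1981.range_baseChange_eq_fixedSubgroup_quadratic`.
[cite: KramerTunnell1982, §5 proof of Prop. 5.11 (p. 326), E(F)/NE(K) ≅ Ĥ⁰(G, E(K))] -/
theorem range_baseChange_eq_fixedSubgroup_of_finrank_two (V : WeierstrassCurve F)
    (h2 : Module.finrank F L = 2) {σ : L ≃ₐ[F] L} (hσ : σ ≠ 1) :
    (WeierstrassCurve.Affine.Point.baseChange (W' := V) F L).range = fixedSubgroup V L σ := by
  ext Q
  constructor
  · rintro ⟨P, rfl⟩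
    exact mem_fixedSubgroup_iff.mpr (Affine.Point.map_baseChange _ P)
  · intro hQ
    exact exists_baseChange_eq_of_map_eq_of_finrank_two V h2 hσ (mem_fixedSubgroup_iff.mp hQ)

end Descent

/-! ## §5 The unramified quadratic extension `K' ⊆ F̄` of a local field `F` -/

section KPrime

open Literature.NumberTheory.EllipticCurves.Kramer1981

variable {F : Type u} [Field F] [ValuativeRel F] [TopologicalSpace F] [IsNonarchimedeanLocalField F]
  (K' : IntermediateField F (AlgebraicClosure F))
  [ValuativeRel K'] [TopologicalSpace K'] [IsNonarchimedeanLocalField K']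
  (hcompat : ∀ y y' : K', y ≤ᵥ y' ↔
    algNorm F (y : AlgebraicClosure F) ≤ algNorm F (y' : AlgebraicClosure F))
  {w : Valuation K' ℝ≥0}
  (hw : ∀ a : K', (w a : ℝ) = algNorm K' (algebraMap K' (AlgebraicClosure K') a))

include hcompat hw

/-- Dictionary: the real valuation `w` of the local field `K'` (normalised to `K'`'s own absolute
value) is monotone in the absolute value of `F̄ ⊇ K'` extending that of `F` — both are the unique
prolongation (Serre, *Local Fields*, Ch. II §2 Cor. 2). [cite: SerreLocalFields1979, Ch. II §2 Prop. 3 and Cor. 2] -/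
theorem val_le_val_iff_algNorm_le (y y' : K') :
    w y ≤ w y' ↔ algNorm F (y : AlgebraicClosure F) ≤ algNorm F (y' : AlgebraicClosure F) := by
  rw [← NNReal.coe_le_coe, hw, hw, algNorm_algebraMap, algNorm_algebraMap, norm_le_norm_iff_vle,
    hcompat]

/-- Dictionary, strict form. [cite: SerreLocalFields1979, Ch. II §2 Prop. 3 and Cor. 2] -/
theorem val_lt_val_iff_algNorm_lt (y y' : K') :
    w y < w y' ↔ algNorm F (y : AlgebraicClosure F) < algNorm F (y' : AlgebraicClosure F) := by
  rw [← not_le, val_le_val_iff_algNorm_le K' hcompat hw, not_le]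

/-- Dictionary, equality form. [cite: SerreLocalFields1979, Ch. II §2 Prop. 3 and Cor. 2] -/
theorem val_eq_val_iff_algNorm_eq (y y' : K') :
    w y = w y' ↔ algNorm F (y : AlgebraicClosure F) = algNorm F (y' : AlgebraicClosure F) := by
  rw [le_antisymm_iff, le_antisymm_iff, val_le_val_iff_algNorm_le K' hcompat hw,
    val_le_val_iff_algNorm_le K' hcompat hw]

omit hcompat hw in
omit [ValuativeRel F] [TopologicalSpace F] [IsNonarchimedeanLocalField F]
  [ValuativeRel K'] [TopologicalSpace K'] [IsNonarchimedeanLocalField K'] in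
/-- `F ⊆ K' ⊆ F̄` (unfolding). [folklore] -/
private theorem coe_algebraMap' (a : F) :
    ((algebraMap F K' a : K') : AlgebraicClosure F) = algebraMap F (AlgebraicClosure F) a := rfl

/-- `|a|_w ≤ 1` for `a ∈ 𝒪[F]`. [folklore] -/
private theorem val_algebraMap_le_one (a : 𝒪[F]) : w (algebraMap F K' (a : F)) ≤ 1 := by
  have h := (val_le_val_iff_algNorm_le K' hcompat hw (algebraMap F K' (a : F)) 1).mpr (by
    rw [coe_algebraMap', OneMemClass.coe_one, algNorm_one]
    exact algNorm_algebraMap_le_one_iff.mpr a.2)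
  rwa [map_one] at h

/-- `|u|_w = 1` for `u ∈ 𝒪[F]ˣ`. [folklore] -/
private theorem val_algebraMap_unit (u : 𝒪[F]ˣ) : w (algebraMap F K' ((u : 𝒪[F]) : F)) = 1 := by
  have hu := algNorm_algebraMap_unit (F := F) u
  rw [IsScalarTower.algebraMap_apply 𝒪[F] F (AlgebraicClosure F)] at hu
  have h := (val_eq_val_iff_algNorm_eq K' hcompat hw (algebraMap F K' ((u : 𝒪[F]) : F)) 1).mpr (by
    rw [coe_algebraMap', OneMemClass.coe_one, algNorm_one]
    exact hu)
  rwa [map_one] at h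

/-- **`σ` is an isometry** (`|σy| = |y|`: uniqueness of the prolongation of the absolute value,
tree `Kramer1981.algNorm_algEquiv`). [cite: SerreLocalFields1979, Ch. II §2 Cor. 3] -/
theorem val_algEquiv (σ : K' ≃ₐ[F] K') (y : K') : w (σ y) = w y :=
  (val_eq_val_iff_algNorm_eq K' hcompat hw _ _).mpr (algNorm_algEquiv σ y)

/-- **`K'/F` unramified: a uniformiser `ϖ` of `F` is a uniformiser of `K' ⊆ F_nr`**
(`|y| < 1 ⇒ |y| ≤ |ϖ|`, tree `exists_algNorm_eq_zpow_of_mem_maxUnramified`).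
[cite: SerreLocalFields1979, Ch. IV §4 Prop. 16 and Cor. 2] -/
theorem val_le_val_uniformizer_of_lt_one (hK' : K' ≤ maxUnramified F) {ϖ : 𝒪[F]}
    (hϖ : Irreducible ϖ) {y : K'} (hy : w y < 1) : w y ≤ w (algebraMap F K' (ϖ : F)) := by
  by_cases hy0 : y = 0
  · rw [hy0, map_zero]; exact zero_le
  rw [val_le_val_iff_algNorm_le K' hcompat hw, coe_algebraMap']
  have hy0' : (y : AlgebraicClosure F) ≠ 0 := fun h => hy0 (by exact_mod_cast h)
  obtain ⟨n, hn⟩ := exists_algNorm_eq_zpow_of_mem_maxUnramified hϖ (hK' y.2) hy0'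
  have hc0 := algNorm_uniformizer_pos (F := F) hϖ
  have hc1 := algNorm_uniformizer_lt_one (F := F) hϖ
  rw [IsScalarTower.algebraMap_apply 𝒪[F] F (AlgebraicClosure F)] at hn hc0 hc1
  have hlt : algNorm F (y : AlgebraicClosure F) < 1 := by
    have h := (val_lt_val_iff_algNorm_lt K' hcompat hw y 1).mp (by rwa [map_one])
    rwa [OneMemClass.coe_one, algNorm_one] at h
  rw [hn] at hlt ⊢
  have hnpos : 0 < n := (zpow_lt_one_iff_right_of_lt_one₀ hc0 hc1).mp hlt
  calc algNorm F (algebraMap F (AlgebraicClosure F) (ϖ : F)) ^ n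
      ≤ algNorm F (algebraMap F (AlgebraicClosure F) (ϖ : F)) ^ (1 : ℤ) :=
        zpow_le_zpow_right_of_le_one₀ hc0 hc1.le hnpos
    _ = _ := zpow_one _

/-- `0 < |ϖ|_w < 1` for a uniformiser `ϖ` of `F`. [folklore] -/
private theorem val_uniformizer_pos_lt_one {ϖ : 𝒪[F]} (hϖ : Irreducible ϖ) :
    0 < w (algebraMap F K' (ϖ : F)) ∧ w (algebraMap F K' (ϖ : F)) < 1 := by
  have hc0 := algNorm_uniformizer_pos (F := F) hϖ
  have hc1 := algNorm_uniformizer_lt_one (F := F) hϖ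
  rw [IsScalarTower.algebraMap_apply 𝒪[F] F (AlgebraicClosure F)] at hc0 hc1
  constructor
  · have h := (val_lt_val_iff_algNorm_lt K' hcompat hw 0 (algebraMap F K' (ϖ : F))).mpr (by
      rw [ZeroMemClass.coe_zero, algNorm_zero, coe_algebraMap']
      exact hc0)
    rwa [map_zero] at h
  · have h := (val_lt_val_iff_algNorm_lt K' hcompat hw (algebraMap F K' (ϖ : F)) 1).mpr (by
      rw [OneMemClass.coe_one, algNorm_one, coe_algebraMap']
      exact hc1)
    rwa [map_one] at h

/-- **`Ĥ⁰(G, E(K')) = 0` for a model with unit discriminant over the unramified quadratic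
extension `K' ⊆ F̄`** (core form, for any local-field structure on `K'` whose valuation is the
restriction of `|·|_{F̄}`): `[E(K')^σ : N E(K')] = 1`.  Instance of
`relIndex_normSubgroup_fixedSubgroup_eq_one_of_unramified` with `π = ϖ_F` (`K'/F` unramified:
`val_le_val_uniformizer_of_lt_one`), `σ` an isometric involution (`val_algEquiv`,
`algEquiv_mul_self_of_finrank_two`).  Kramer–Tunnell, Lemma 6.1, type `I₀`.
[cite: KramerTunnell1982, §6 Lemma 6.1 and its proof (p. 327), type I₀] -/
theorem relIndex_normSubgroup_fixedSubgroup_eq_one_of_isUnit_Δ_aux [dK : DecidableEq K']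
    (W : WeierstrassCurve 𝒪[F]) (hΔ : IsUnit W.Δ) (hK' : K' ≤ maxUnramified F)
    (h2 : Module.finrank F K' = 2) {σ : K' ≃ₐ[F] K'} (hσ : σ ≠ 1) :
    (normSubgroup (W.baseChange F) K' σ).relIndex (fixedSubgroup (W.baseChange F) K' σ) = 1 := by
  -- the abstract theorems are stated for the classical `DecidableEq` instance
  have hdK : dK = fun a b => Classical.propDecidable (a = b) := Subsingleton.elim _ _
  subst hdK
  haveI : ((W.baseChange F).baseChange K').IsElliptic :=
    ⟨by rw [WeierstrassCurve.baseChange, map_Δ, WeierstrassCurve.baseChange, map_Δ]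
        exact (hΔ.map _).map _⟩
  haveI : ((W.baseChange F).baseChange K').IsIntegral w.integer := by
    refine isIntegral_of_exists_lift _ ?_ ?_ ?_ ?_ ?_
    · exact ⟨⟨algebraMap F K' (W.a₁ : F), val_algebraMap_le_one K' hcompat hw _⟩, rfl⟩
    · exact ⟨⟨algebraMap F K' (W.a₂ : F), val_algebraMap_le_one K' hcompat hw _⟩, rfl⟩
    · exact ⟨⟨algebraMap F K' (W.a₃ : F), val_algebraMap_le_one K' hcompat hw _⟩, rfl⟩
    · exact ⟨⟨algebraMap F K' (W.a₄ : F), val_algebraMap_le_one K' hcompat hw _⟩, rfl⟩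
    · exact ⟨⟨algebraMap F K' (W.a₆ : F), val_algebraMap_le_one K' hcompat hw _⟩, rfl⟩
  have hΔ' : w ((W.baseChange F).baseChange K').Δ = 1 := by
    rw [WeierstrassCurve.baseChange, map_Δ, WeierstrassCurve.baseChange, map_Δ]
    obtain ⟨u, hu⟩ := hΔ
    rw [← hu]
    exact val_algebraMap_unit K' hcompat hw u
  obtain ⟨ϖ, hϖ⟩ := IsDiscreteValuationRing.exists_irreducible 𝒪[F]
  obtain ⟨hπ0, hπ1⟩ := val_uniformizer_pos_lt_one K' hcompat hw hϖ
  have hσσ : ∀ y, σ (σ y) = y := fun y => by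
    rw [← AlgEquiv.mul_apply, algEquiv_mul_self_of_finrank_two h2 hσ, AlgEquiv.one_apply]
  exact relIndex_normSubgroup_fixedSubgroup_eq_one_of_unramified (W.baseChange F) hw hΔ'
    (val_algEquiv K' hcompat hw σ) hσσ hσ (σ.commutes (ϖ : F)) hπ0 hπ1
    (fun y hy => val_le_val_uniformizer_of_lt_one K' hcompat hw hK' hϖ hy)

/-- **`H¹(G, E(K')) = 0`**, core form (as above): every `P ∈ E(K')` with `P + σP = O` is
`σQ - Q`. [cite: KramerTunnell1982, §6 proof of Lemma 6.1 (p. 327), |H¹(G, E₀(K))| = 1] -/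
theorem exists_map_sub_eq_of_isUnit_Δ_aux [dK : DecidableEq K'] (W : WeierstrassCurve 𝒪[F])
    (hΔ : IsUnit W.Δ) (hK' : K' ≤ maxUnramified F) (h2 : Module.finrank F K' = 2)
    {σ : K' ≃ₐ[F] K'} (hσ : σ ≠ 1) {P : ((W.baseChange F).baseChange K').toAffine.Point}
    (hP : P + WeierstrassCurve.Affine.Point.map (W' := W.baseChange F) (σ : K' →ₐ[F] K') P = 0) :
    ∃ Q : ((W.baseChange F).baseChange K').toAffine.Point,
      WeierstrassCurve.Affine.Point.map (W' := W.baseChange F) (σ : K' →ₐ[F] K') Q - Q = P := by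
  have hdK : dK = fun a b => Classical.propDecidable (a = b) := Subsingleton.elim _ _
  subst hdK
  haveI : ((W.baseChange F).baseChange K').IsElliptic :=
    ⟨by rw [WeierstrassCurve.baseChange, map_Δ, WeierstrassCurve.baseChange, map_Δ]
        exact (hΔ.map _).map _⟩
  haveI : ((W.baseChange F).baseChange K').IsIntegral w.integer := by
    refine isIntegral_of_exists_lift _ ?_ ?_ ?_ ?_ ?_
    · exact ⟨⟨algebraMap F K' (W.a₁ : F), val_algebraMap_le_one K' hcompat hw _⟩, rfl⟩
    · exact ⟨⟨algebraMap F K' (W.a₂ : F), val_algebraMap_le_one K' hcompat hw _⟩, rfl⟩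
    · exact ⟨⟨algebraMap F K' (W.a₃ : F), val_algebraMap_le_one K' hcompat hw _⟩, rfl⟩
    · exact ⟨⟨algebraMap F K' (W.a₄ : F), val_algebraMap_le_one K' hcompat hw _⟩, rfl⟩
    · exact ⟨⟨algebraMap F K' (W.a₆ : F), val_algebraMap_le_one K' hcompat hw _⟩, rfl⟩
  have hΔ' : w ((W.baseChange F).baseChange K').Δ = 1 := by
    rw [WeierstrassCurve.baseChange, map_Δ, WeierstrassCurve.baseChange, map_Δ]
    obtain ⟨u, hu⟩ := hΔ
    rw [← hu]
    exact val_algebraMap_unit K' hcompat hw u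
  obtain ⟨ϖ, hϖ⟩ := IsDiscreteValuationRing.exists_irreducible 𝒪[F]
  obtain ⟨hπ0, hπ1⟩ := val_uniformizer_pos_lt_one K' hcompat hw hϖ
  have hσσ : ∀ y, σ (σ y) = y := fun y => by
    rw [← AlgEquiv.mul_apply, algEquiv_mul_self_of_finrank_two h2 hσ, AlgEquiv.one_apply]
  have h := ker_norm_le_range_of_unramified (W.baseChange F) hw hΔ'
    (val_algEquiv K' hcompat hw σ) hσσ hσ (σ.commutes (ϖ : F)) hπ0 hπ1
    (fun y hy => val_le_val_uniformizer_of_lt_one K' hcompat hw hK' hϖ hy)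
  -- `P ∈ ker (1 + σ)` and `(σ - 1) Q = P` unfold definitionally to the displayed equations
  obtain ⟨Q, hQ⟩ := @h P (by exact hP)
  exact ⟨Q, hQ⟩

end KPrime

/-! ## §6 The theorem: `[E(K')^σ : N E(K')] = 1` for good reduction (Kramer–Tunnell, Lemma 6.1, type I₀) -/

section Final

open Literature.NumberTheory.EllipticCurves.Kramer1981
open Literature.NumberTheory.DiophantineGeometry

variable {F : Type u} [Field F] [ValuativeRel F] [TopologicalSpace F] [IsNonarchimedeanLocalField F]

/-- The valuation of the finite extension `K' ⊆ F̄` of `F` (tree `FiniteExtension.valuativeRel`,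
the spectral norm) is the restriction of the absolute value of `F̄` (Mathlib
`spectralNorm.eq_of_tower`). [cite: SerreLocalFields1979, Ch. II §2 Prop. 3 and Cor. 2] -/
theorem finiteExtension_vle_iff_algNorm_le (K' : IntermediateField F (AlgebraicClosure F))
    [FiniteDimensional F K'] (y y' : K') :
    @ValuativeRel.vle K' _ (FiniteExtension.valuativeRel F K') y y' ↔
      algNorm F (y : AlgebraicClosure F) ≤ algNorm F (y' : AlgebraicClosure F) := by
  letI := nontriviallyNormedField F
  rw [FiniteExtension.vle_iff_norm_le, FiniteExtension.norm_def, FiniteExtension.norm_def,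
    algNorm_def, algNorm_def, spectralNorm.eq_of_tower (L := AlgebraicClosure F) y,
    spectralNorm.eq_of_tower (L := AlgebraicClosure F) y']
  rfl

/-- **`[E(K')^σ : N E(K')] = 1` for a Weierstrass model with unit discriminant** over the
unramified quadratic extension `K'/F` of a non-archimedean local field (any characteristic, any
residue characteristic): every `σ`-invariant point of `E(K')` is a norm `Q + σQ`.  Kramer–Tunnell,
Lemma 6.1 (type `I₀`: "It follows from Lang's theorem [9] that `N : E₀(K) → E₀(F)` is
surjective").  Proof: endow `K'` with its local-field structure (`FiniteExtension.*`, Serre II §2)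
and apply `relIndex_normSubgroup_fixedSubgroup_eq_one_of_isUnit_Δ_aux`.
[cite: KramerTunnell1982, §6 Lemma 6.1 and its proof (p. 327), type I₀] -/
theorem relIndex_normSubgroup_fixedSubgroup_eq_one_of_isUnit_Δ (W : WeierstrassCurve 𝒪[F])
    (hΔ : IsUnit W.Δ) {K' : IntermediateField F (AlgebraicClosure F)} [DecidableEq K']
    (hK' : K' ≤ maxUnramified F) (h2 : Module.finrank F K' = 2) {σ : K' ≃ₐ[F] K'} (hσ : σ ≠ 1) :
    (normSubgroup (W.baseChange F) K' σ).relIndex (fixedSubgroup (W.baseChange F) K' σ) = 1 := by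
  haveI : FiniteDimensional F K' := Module.finite_of_finrank_eq_succ h2
  letI := FiniteExtension.valuativeRel F K'
  letI := FiniteExtension.topologicalSpace F K'
  haveI := FiniteExtension.isNonarchimedeanLocalField F K'
  obtain ⟨w, hw⟩ := exists_valuation_eq_algNorm (F := K')
  exact relIndex_normSubgroup_fixedSubgroup_eq_one_of_isUnit_Δ_aux K'
    (finiteExtension_vle_iff_algNorm_le K') hw W hΔ hK' h2 hσ

/-- **`H¹(G, E(K')) = 0` for a Weierstrass model with unit discriminant** over the unramified
quadratic extension `K'/F`: every `P ∈ E(K')` with `P + σP = O` is `σQ - Q`.  Kramer–Tunnell,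
proof of Lemma 6.1 ("`|H¹(G, E₀(K))| = 1`"). [cite: KramerTunnell1982, §6 proof of Lemma 6.1 (p. 327), |H¹(G, E₀(K))| = 1] -/
theorem exists_map_sub_eq_of_isUnit_Δ (W : WeierstrassCurve 𝒪[F]) (hΔ : IsUnit W.Δ)
    {K' : IntermediateField F (AlgebraicClosure F)} [DecidableEq K'] (hK' : K' ≤ maxUnramified F)
    (h2 : Module.finrank F K' = 2) {σ : K' ≃ₐ[F] K'} (hσ : σ ≠ 1)
    {P : ((W.baseChange F).baseChange K').toAffine.Point}
    (hP : P + WeierstrassCurve.Affine.Point.map (W' := W.baseChange F) (σ : K' →ₐ[F] K') P = 0) :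
    ∃ Q : ((W.baseChange F).baseChange K').toAffine.Point,
      WeierstrassCurve.Affine.Point.map (W' := W.baseChange F) (σ : K' →ₐ[F] K') Q - Q = P := by
  haveI : FiniteDimensional F K' := Module.finite_of_finrank_eq_succ h2
  letI := FiniteExtension.valuativeRel F K'
  letI := FiniteExtension.topologicalSpace F K'
  haveI := FiniteExtension.isNonarchimedeanLocalField F K'
  obtain ⟨w, hw⟩ := exists_valuation_eq_algNorm (F := K')
  exact exists_map_sub_eq_of_isUnit_Δ_aux K' (finiteExtension_vle_iff_algNorm_le K') hw W hΔ hK'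
    h2 hσ hP

end Final

section TypeI0

open Literature.NumberTheory.EllipticCurves.Kramer1981
open Literature.NumberTheory.DiophantineGeometry

variable {F : Type} [Field F] [ValuativeRel F] [TopologicalSpace F] [IsNonarchimedeanLocalField F]

/-- **Kramer–Tunnell 1982, Lemma 6.1, type `I₀`, PROVED** (the good-reduction case of the named
fact `lemma61_unramifiedNormIndex`, verbatim in its vocabulary): for `E/F` an elliptic curve over a
non-archimedean local field with Kodaira symbol `I₀` (good reduction of the minimal model) and
`K'/F` the unramified quadratic extension with `Gal(K'/F) = ⟨σ⟩`, the norm index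
`[E(K')^σ : N E(K')]` is `2^d` with `d ≡ numComponents(I₀) - 1 = 0 (mod 2)` — indeed it is `1`.
Assembly: minimal model `E.minimal = C • E` (the index is model-independent,
`Kramer1981.relIndex_norm_fixed_smul`), its integral model `W` has unit discriminant
(`kodairaSymbol_eq_I_zero_iff`, `hasGoodReduction_iff_isElliptic_reduction`), and
`relIndex_normSubgroup_fixedSubgroup_eq_one_of_isUnit_Δ`.
[cite: KramerTunnell1982, §6 Lemma 6.1 (p. 327), type I₀] -/
theorem lemma61_unramifiedNormIndex_typeI0 (E : WeierstrassCurve F) [E.IsElliptic]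
    (K' : IntermediateField F (AlgebraicClosure F)) [DecidableEq K'] (hK' : K' ≤ maxUnramified F)
    (h2 : Module.finrank F K' = 2) (σ : K' ≃ₐ[F] K') (hσ : σ ≠ 1)
    (hI0 : E.kodairaSymbol 𝒪[F] = .I 0) :
    (∃ d : ℕ, (normSubgroup E K' σ).relIndex (fixedSubgroup E K' σ) = 2 ^ d ∧
        d % 2 = ((E.kodairaSymbol 𝒪[F]).numComponents - 1) % 2) ∧
      (normSubgroup E K' σ).relIndex (fixedSubgroup E K' σ) = 1 := by
  -- the minimal model `E.minimal = C • E` and its integral model `W` over `𝒪[F]`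
  obtain ⟨C, hC⟩ : ∃ C : VariableChange F, E.minimal 𝒪[F] = C • E := ⟨_, rfl⟩
  obtain ⟨W, hW⟩ : ∃ W : WeierstrassCurve 𝒪[F], W = (E.minimal 𝒪[F]).integralModel 𝒪[F] :=
    ⟨_, rfl⟩
  have hWV : W.baseChange F = E.minimal 𝒪[F] := by
    rw [hW]; exact WeierstrassCurve.baseChange_integralModel_eq 𝒪[F] _
  have hred : (E.minimal 𝒪[F]).reduction 𝒪[F] = W.map (IsLocalRing.residue 𝒪[F]) := by
    rw [hW]; rfl
  -- good reduction: `W` has unit discriminant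
  have hgood : (E.minimal 𝒪[F]).HasGoodReduction 𝒪[F] :=
    (kodairaSymbol_eq_I_zero_iff 𝒪[F] E).mp hI0
  have hΔ : IsUnit W.Δ := by
    have h := ((WeierstrassCurve.hasGoodReduction_iff_isElliptic_reduction 𝒪[F]).mp hgood).isUnit
    rw [hred, WeierstrassCurve.map_Δ] at h
    exact (isUnit_map_iff (IsLocalRing.residue 𝒪[F]) _).mp h
  have key : (normSubgroup E K' σ).relIndex (fixedSubgroup E K' σ) = 1 := by
    rw [← relIndex_norm_fixed_smul E C σ, ← hC, ← hWV]
    exact relIndex_normSubgroup_fixedSubgroup_eq_one_of_isUnit_Δ W hΔ hK' h2 hσ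
  refine ⟨⟨0, ?_, ?_⟩, key⟩
  · rw [key, pow_zero]
  · rw [hI0, KodairaSymbol.numComponents_I_zero]

/-- **`H¹(G, E(K')) = 0` for good reduction (type `I₀`)** over the unramified quadratic extension
`K'/F` of a non-archimedean local field: every `P ∈ E(K')` with `P + σP = O` is `σQ - Q`.
Kramer–Tunnell, proof of Lemma 6.1 ("`|H¹(G, E₀(K))| = |E(F)/N E₀(K)| = 1`"; type `I₀`:
`E₀ = E`).  Transport of `exists_map_sub_eq_of_isUnit_Δ` from the minimal model along the
`σ`-equivariant isomorphism `E(K') ≃ (C • E)(K')` (`VariableChange.pointEquivBaseChange`).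
[cite: KramerTunnell1982, §6 proof of Lemma 6.1 (p. 327), |H¹(G, E₀(K))| = 1] -/
theorem exists_map_sub_eq_of_kodairaSymbol_I_zero (E : WeierstrassCurve F) [E.IsElliptic]
    {K' : IntermediateField F (AlgebraicClosure F)} [DecidableEq K'] (hK' : K' ≤ maxUnramified F)
    (h2 : Module.finrank F K' = 2) {σ : K' ≃ₐ[F] K'} (hσ : σ ≠ 1)
    (hI0 : E.kodairaSymbol 𝒪[F] = .I 0) {P : (E.baseChange K').toAffine.Point}
    (hP : P + WeierstrassCurve.Affine.Point.map (W' := E) (σ : K' →ₐ[F] K') P = 0) :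
    ∃ Q : (E.baseChange K').toAffine.Point,
      WeierstrassCurve.Affine.Point.map (W' := E) (σ : K' →ₐ[F] K') Q - Q = P := by
  obtain ⟨C, hC⟩ : ∃ C : VariableChange F, E.minimal 𝒪[F] = C • E := ⟨_, rfl⟩
  obtain ⟨W, hW⟩ : ∃ W : WeierstrassCurve 𝒪[F], W = (E.minimal 𝒪[F]).integralModel 𝒪[F] :=
    ⟨_, rfl⟩
  have hWV : W.baseChange F = E.minimal 𝒪[F] := by
    rw [hW]; exact WeierstrassCurve.baseChange_integralModel_eq 𝒪[F] _
  have hred : (E.minimal 𝒪[F]).reduction 𝒪[F] = W.map (IsLocalRing.residue 𝒪[F]) := by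
    rw [hW]; rfl
  have hgood : (E.minimal 𝒪[F]).HasGoodReduction 𝒪[F] :=
    (kodairaSymbol_eq_I_zero_iff 𝒪[F] E).mp hI0
  have hΔ : IsUnit W.Δ := by
    have h := ((WeierstrassCurve.hasGoodReduction_iff_isElliptic_reduction 𝒪[F]).mp hgood).isUnit
    rw [hred, WeierstrassCurve.map_Δ] at h
    exact (isUnit_map_iff (IsLocalRing.residue 𝒪[F]) _).mp h
  have main : ∀ (V : WeierstrassCurve F), V = W.baseChange F →
      ∀ P' : (V.baseChange K').toAffine.Point,
        P' + WeierstrassCurve.Affine.Point.map (W' := V) (σ : K' →ₐ[F] K') P' = 0 →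
        ∃ Q' : (V.baseChange K').toAffine.Point,
          WeierstrassCurve.Affine.Point.map (W' := V) (σ : K' →ₐ[F] K') Q' - Q' = P' := by
    rintro V rfl P' hP'
    exact exists_map_sub_eq_of_isUnit_Δ W hΔ hK' h2 hσ hP'
  obtain ⟨Q', hQ'⟩ := main (C • E) (hWV.trans hC).symm
    (VariableChange.pointEquivBaseChange E C K' P) (by
      rw [← VariableChange.pointEquivBaseChange_map_algEquiv, ← map_add, hP, map_zero])
  refine ⟨(VariableChange.pointEquivBaseChange E C K').symm Q', ?_⟩
  apply (VariableChange.pointEquivBaseChange E C K').injective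
  rw [map_sub, VariableChange.pointEquivBaseChange_map_algEquiv, AddEquiv.apply_symm_apply, hQ']

/-- **Reduction of the named fact to the remaining Kodaira types.**  With the type-`I₀` case proved
(`lemma61_unramifiedNormIndex_typeI0`), Kramer–Tunnell's Lemma 6.1 as typed
(`lemma61_unramifiedNormIndex`) follows from its restriction to curves with
`E.kodairaSymbol 𝒪[F] ≠ I₀` (types `I_v (v ≥ 1), II, III, IV, I₀*, I_v*, IV*, III*, II*` — the
component-group cases of the printed proof, pp. 327–328).  A bookkeeping theorem for the remaining
stages; no new hypothesis is introduced as a named fact.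
[cite: KramerTunnell1982, §6 Lemma 6.1 and its proof (pp. 327–328)] -/
theorem lemma61_unramifiedNormIndex_of_ne_I_zero
    (hrest : ∀ (F : Type) [Field F] [ValuativeRel F] [TopologicalSpace F]
      [IsNonarchimedeanLocalField F] (E : WeierstrassCurve F) [E.IsElliptic]
      (K' : IntermediateField F (AlgebraicClosure F)) (_hK' : K' ≤ maxUnramified F)
      (_h2 : Module.finrank F K' = 2) (σ : K' ≃ₐ[F] K') (_hσ : σ ≠ 1),
      E.kodairaSymbol 𝒪[F] ≠ .I 0 →
      (∃ d : ℕ, (normSubgroup E K' σ).relIndex (fixedSubgroup E K' σ) = 2 ^ d ∧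
          d % 2 = ((E.kodairaSymbol 𝒪[F]).numComponents - 1) % 2) ∧
        ((E.kodairaSymbol 𝒪[F] = .I 0 ∨ (∃ v : ℕ, Odd v ∧ E.kodairaSymbol 𝒪[F] = .I v) ∨
            E.kodairaSymbol 𝒪[F] = .II ∨ E.kodairaSymbol 𝒪[F] = .IIstar ∨
            E.kodairaSymbol 𝒪[F] = .IV ∨ E.kodairaSymbol 𝒪[F] = .IVstar) →
          (normSubgroup E K' σ).relIndex (fixedSubgroup E K' σ) = 1)) :
    lemma61_unramifiedNormIndex := by
  intro F _ _ _ _ E _ K' hK' h2 σ hσ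
  by_cases hI0 : E.kodairaSymbol 𝒪[F] = .I 0
  · obtain ⟨hd, h1⟩ := lemma61_unramifiedNormIndex_typeI0 E K' hK' h2 σ hσ hI0
    exact ⟨hd, fun _ => h1⟩
  · exact hrest F E K' hK' h2 σ hσ hI0

end TypeI0

end Literature.NumberTheory.EllipticCurves.KramerTunnell1982
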